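import Summits.KontsevichZagierPeriods.KontsevichZagierPeriods.Theses.CarlsonRule
import Literature.NumberTheory.Transcendental.KZLogCalculusProofs

/-!
# `CarlsonClosure` (stmt-KontsevichZagierPeriods-12256, route CarlsonRule) — birth skeleton

Crux (rank 3, verbatim the route decl `…Theses.CarlsonRule.CarlsonClosure`, "CARLSON'S RULE IS
ADMISSIBLE for the four-move calculus"): for `σ ⊆ ℝⁿ`, `τ ⊆ ℝ^{n'}`, functions `f, g` on `σ` and
`f', g'` on `τ` with `0 ≤ g, g' ≤ M`, and families of representations `r m = [σ, f·g^m]`,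
`s m = [τ, f'·g'^m]` (`m ∈ ℕ`) with `[r m] − [s m] ∈ KZ.relations` for every `m`, every pair
`rk = [σ, f·g^k]`, `sk = [τ, f'·g'^k]` with `k ∈ ℚ`, `k ≥ 0`, has `[rk] − [sk] ∈ KZ.relations`.

## The line "birth": THE DENOMINATOR TOWER — Carlson's rule is generated by its prime-root anchors

Write `Prem` for the premisses of the rule at one datum `(σ, τ, f, g, f', g', M, r, s)` and
`Concl e` for its conclusion at one REAL exponent `e` (both verbatim sub-formulas of the crux).
For `q ∈ ℕ` put

* `RootRule q`     : `Prem → ∀ p : ℕ, Concl (p / q)`   (the rule at denominator `q`),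
* `UnitRootRule q` : `Prem → Concl (1 / q)`             (the `q`-TH ROOT ANCHOR: adjoining `g^{1/q}`).

`CarlsonClosure` is, after writing `k = num / den`, `∀ q ≥ 1, RootRule q` (`carlsonClosure_of_rootRule`,
proved here). The observation carrying the line: the rule BOOTSTRAPS along towers of root extractions,
because the conclusion of one instance is the ω-premiss of the next —

1. NUMERATOR FREEDOM (`rootRule_of_unitRootRule`, proved here): `UnitRootRule q → RootRule q` — the
   anchor applied to the datum `(f, g^p; f', g'^p; M^p)`, whose integer points `m ↦ r (p·m)` are a
   sub-family of the given ones, yields the exponent `p/q` (`(g^p)^{1/q} = g^{p/q}`, `Real.rpow_mul`).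
2. INTEGER CASE (`rootRule_one`, proved here; = §7 of `Cruxes/CarlsonKernel/Attack.lean`): at `k = p ∈ ℕ`
   the conclusion is the `p`-th premiss up to two congruences (`KZ.of_sub_of_mem_relations_of_eqOn`,
   `Real.rpow_natCast`).
3. ROOT TOWER (stub `stub_rootTower`): `RootRule a → UnitRootRule b → UnitRootRule (a·b)` — apply the
   `b`-th root anchor to the datum `(f, g^{1/a}; f', g'^{1/a}; M^{1/a})`, whose ω-premiss (all integer
   powers of `g^{1/a}`, i.e. all exponents `m/a` of `g`) is supplied by `RootRule a`; this needs the
   interpolating representations `[σ, f·g^{m/a}]` to EXIST as `KZ.IntegralRep`s, which is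
4. INTERPOLANTS EXIST (stub `stub_interpolantsExist`): from the integer-point family alone (`r 0 = [σ, f]`,
   `r 1 = [σ, f g]` give `f` and, on `σ ∩ {f ≠ 0}`, `g = (f g)/f` as `ℚ`-semialgebraic functions;
   `x ↦ (g x)^k` is semialgebraic for rational `k` by `IsSemialgebraicFunOn.rpow_ratCast_of_nonneg`;
   `|f g^k| ≤ |f| + |f g^⌈k⌉|` gives absolute integrability), `[σ, f·g^k]` is a representation for every
   rational `k ≥ 0`.
5. PRIME-ROOT ANCHORS (stub `stub_primeRootAnchor`, THE OPEN CORE): `UnitRootRule p` for every prime `p` —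
   "adjoining a prime root of `g` is admissible": from `[σ, f g^m] ∼ [τ, f' g'^m]` for all `m ∈ ℕ` infer
   `[σ, f g^{1/p}] ∼ [τ, f' g'^{1/p}]`.

Multiplicative induction (`Nat.recOnMul`: `1`, primes, products; `rootRule_of_prime_of_tower`) then gives
`RootRule q` for every `q ≥ 1`, hence (`ratRule_of_rootRule`, `k = num/den`) the crux in its curried
vocabulary form `RatRule` (`ratRule_iff_carlsonClosure`, definitional): `CarlsonClosure_of : stub₁-sig →
stub₂-sig → stub₃-sig → CarlsonClosure` is sorry-free and concludes the route declaration BY NAME — its three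
hypotheses are the obligation nodes `Obligation.stub_*` (each DEFINED as the corresponding stub's signature and
named by its stub, so that `#h21_check_skeleton` admits them by name whichever crux-concluding theorem it keys
on); `carlsonClosure_skeleton : CarlsonClosure` feeds the three sorried stubs in (no hypotheses). No other
theorem of this file concludes the crux. What the skeleton certifies: the ω-rule need only be established for the anchors
`k = 1/p`, `p` prime (Gauss's reduction of cyclotomy to prime level, here for exponent interpolation);
the two reduction stubs are provable now (sizes M), the anchor stub is the crux's genuine content
(route header: "the anchors k₀ ∈ (0,1) are the content"; the G₂ cruxes `G2ThirdAnchor` (p = 3) and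
support `G2HalfRational` (p = 2) of the route are its first instances).

Hardest stub: `stub_primeRootAnchor` (open-problem grade, exactly the non-integral content of the rule;
why it might fail = the crux's: one inaccessible anchor, e.g. a Neg witness at Gauss triplication
`p = 3`, kills it, the crux and the summit together — `Cruxes/CarlsonKernel/Attack.lean` §3:
`KontsevichZagierPeriods → CarlsonClosure` given the PROVED `CarlsonSound`).
Disproof used: none on file (`ledger crux ls stmt-KontsevichZagierPeriods-12256`: no `Disproof.lean`, no
dead lines, no ideas; `ledger negatives --problem KontsevichZagierPeriods` has no exponent-interpolation
entry). The sibling attack `Cruxes/CarlsonKernel/Attack.lean` is honoured: its §7 (integer exponents are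
free) is `rootRule_one`; its §9 (value-level soundness by Weierstrass) says every stub here is SOUND at
the value level (no stub asserts a move-equivalence between value-different representations).
BC3 probes (registrar, 2026-08-17; files `bc/probe_crux.lean`, `bc/probe_summit.lean` attached as evidence:
this file's vocabulary copied verbatim, no stub and no composition theorem in scope): for each of the three
stub statements `S`, `set_option maxHeartbeats 400000 in example : S → CarlsonClosure := by
first | exact? | simpa | aesop` FAILS (rc 1, "unsolved goals ⊢ CarlsonClosure", "aesop: failed to prove the
goal after exhaustive search") and so does `… := by exact?` alone ("`exact?` could not close the goal");
the same six probes against `KontsevichZagierPeriods` FAIL identically (rc 1). No stub is cheaply the crux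
or the summit: 12/12 probes failed. (Conversely stubs 1 and 3 are INSTANCES of the crux — `UnitRootRule q`
is its case `k = 1/q` — hence weaker-or-equal, and stub 2 is an unconditional existence statement.)
This file: `lean check --json` rc 0, sorries = 3 = the three `stub_*` (lines of `stub_primeRootAnchor`,
`stub_interpolantsExist`, `stub_rootTower`), zero elsewhere; `CarlsonClosure_of` axioms
`[propext, Classical.choice, Quot.sound]` (no `sorryAx`); audit: `carlsonClosure_skeleton` proves
`…Theses.CarlsonRule.CarlsonClosure (route_item route-KontsevichZagierPeriods-CarlsonRule)` modulo `sorryAx`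
of the stubs only.
-/

set_option linter.dupNamespace false

noncomputable section

namespace Summit.KontsevichZagierPeriods.KontsevichZagierPeriods.Cruxes.CarlsonClosure.Birth

open Set
open Literature.NumberTheory.Transcendental
open Summit.KontsevichZagierPeriods.KontsevichZagierPeriods.Theses.CarlsonRule (CarlsonClosure)

/-! ## Vocabulary: premisses, conclusion at a real exponent, the rule at one denominator -/

/-- The PREMISSES of Carlson's rule at one datum `(σ, τ, f, g, f', g', M, r, s)` — verbatim the five
hypotheses of the crux: `0 ≤ g ≤ M` on `σ`, `0 ≤ g' ≤ M` on `τ`, `r m = [σ, f·g^m]`, `s m = [τ, f'·g'^m]`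
and `[r m] − [s m] ∈ KZ.relations` for every `m ∈ ℕ`. [cite: KontsevichZagier2001, §1.2] -/
def Prem (n n' : ℕ) (σ : Set (Fin n → ℝ)) (τ : Set (Fin n' → ℝ)) (f g : (Fin n → ℝ) → ℝ)
    (f' g' : (Fin n' → ℝ) → ℝ) (M : ℝ) (r : ℕ → KZ.IntegralRep n) (s : ℕ → KZ.IntegralRep n') :
    Prop :=
  (∀ x ∈ σ, 0 ≤ g x ∧ g x ≤ M) ∧ (∀ y ∈ τ, 0 ≤ g' y ∧ g' y ≤ M) ∧
  (∀ m, (r m).domain = σ ∧ EqOn (r m).integrand (fun x => f x * g x ^ m) σ) ∧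
  (∀ m, (s m).domain = τ ∧ EqOn (s m).integrand (fun y => f' y * g' y ^ m) τ) ∧
  (∀ m, KZ.of (r m) - KZ.of (s m) ∈ KZ.relations)

/-- The CONCLUSION of Carlson's rule at one real exponent `e`: every pair of representations
`rk = [σ, f·g^e]`, `sk = [τ, f'·g'^e]` is a KZ relation — verbatim the crux's conclusion with `(k : ℝ)`
replaced by `e`. [cite: KontsevichZagier2001, §1.2] -/
def Concl (n n' : ℕ) (σ : Set (Fin n → ℝ)) (τ : Set (Fin n' → ℝ)) (f g : (Fin n → ℝ) → ℝ)
    (f' g' : (Fin n' → ℝ) → ℝ) (e : ℝ) : Prop :=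
  ∀ (rk : KZ.IntegralRep n) (sk : KZ.IntegralRep n'), rk.domain = σ →
    EqOn rk.integrand (fun x => f x * g x ^ e) σ → sk.domain = τ →
    EqOn sk.integrand (fun y => f' y * g' y ^ e) τ → KZ.of rk - KZ.of sk ∈ KZ.relations

/-- CARLSON'S RULE AT DENOMINATOR `q`: the premisses give the conclusion at every exponent `p/q`,
`p ∈ ℕ`. (`RootRule 1` is the integer case; `CarlsonClosure ↔ ∀ q ≥ 1, RootRule q`.)
[cite: KontsevichZagier2001, §1.2] -/
def RootRule (q : ℕ) : Prop :=
  ∀ (n n' : ℕ) (σ : Set (Fin n → ℝ)) (τ : Set (Fin n' → ℝ)) (f g : (Fin n → ℝ) → ℝ)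
    (f' g' : (Fin n' → ℝ) → ℝ) (M : ℝ) (r : ℕ → KZ.IntegralRep n) (s : ℕ → KZ.IntegralRep n'),
    Prem n n' σ τ f g f' g' M r s → ∀ p : ℕ, Concl n n' σ τ f g f' g' ((p : ℝ) / (q : ℝ))

/-- THE `q`-TH ROOT ANCHOR: the premisses give the conclusion at the single exponent `1/q`
("adjoining the `q`-th root of `g` is admissible"). It is the instance `k = 1/q` of the crux.
[cite: KontsevichZagier2001, §1.2] -/
def UnitRootRule (q : ℕ) : Prop :=
  ∀ (n n' : ℕ) (σ : Set (Fin n → ℝ)) (τ : Set (Fin n' → ℝ)) (f g : (Fin n → ℝ) → ℝ)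
    (f' g' : (Fin n' → ℝ) → ℝ) (M : ℝ) (r : ℕ → KZ.IntegralRep n) (s : ℕ → KZ.IntegralRep n'),
    Prem n n' σ τ f g f' g' M r s → Concl n n' σ τ f g f' g' ((1 : ℝ) / (q : ℝ))

/-- INTERPOLANTS EXIST: given one side of the premisses (the bound `0 ≤ g ≤ M` on `σ` and the family
`r m = [σ, f·g^m]`, `m ∈ ℕ`, of genuine `KZ.IntegralRep`s), the interpolated datum `[σ, f·g^k]` is a
Kontsevich–Zagier integral representation for every rational `k ≥ 0` (ℚ-semialgebraic integrand on `σ`,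
absolutely integrable). [cite: KontsevichZagier2001, §1.1] -/
def InterpolantsExist : Prop :=
  ∀ (n : ℕ) (σ : Set (Fin n → ℝ)) (f g : (Fin n → ℝ) → ℝ) (M : ℝ) (r : ℕ → KZ.IntegralRep n),
    (∀ x ∈ σ, 0 ≤ g x ∧ g x ≤ M) →
    (∀ m, (r m).domain = σ ∧ EqOn (r m).integrand (fun x => f x * g x ^ m) σ) →
    ∀ k : ℚ, 0 ≤ k → ∃ rk : KZ.IntegralRep n, rk.domain = σ ∧
      EqOn rk.integrand (fun x => f x * g x ^ (k : ℝ)) σ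

/-- CARLSON'S RULE AT EVERY RATIONAL EXPONENT, in the vocabulary `Prem`/`Concl`: this is the crux itself,
curried (`ratRule_iff_carlsonClosure` is proved by re-bracketing the premisses). [cite: KontsevichZagier2001, §1.2] -/
def RatRule : Prop :=
  ∀ (n n' : ℕ) (σ : Set (Fin n → ℝ)) (τ : Set (Fin n' → ℝ)) (f g : (Fin n → ℝ) → ℝ)
    (f' g' : (Fin n' → ℝ) → ℝ) (M : ℝ) (r : ℕ → KZ.IntegralRep n) (s : ℕ → KZ.IntegralRep n'),
    Prem n n' σ τ f g f' g' M r s → ∀ k : ℚ, 0 ≤ k → Concl n n' σ τ f g f' g' (k : ℝ)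

/-! ## Obligation nodes: the stub statements, named by their stubs

`#h21_check_skeleton` admits as hypotheses of the crux-concluding theorem exactly the registered obligations /
declared stubs BY NAME. The three `Prop`s below are, by definition, the signatures of the three registered stubs
`stub_primeRootAnchor`, `stub_interpolantsExist`, `stub_rootTower` (declared right after, each `:= by sorry`),
and carry the same short names inside the sub-namespace `Obligation`; `CarlsonClosure_of` takes them as its
hypotheses and `carlsonClosure_skeleton` instantiates them with the stubs (definitional unfolding). -/

namespace Obligation

/-- Obligation node of stub 1 (`stub_primeRootAnchor`): PRIME-ROOT ANCHORS — for every prime `p`, the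
premisses of Carlson's rule give its conclusion at the exponent `1/p`. [cite: KontsevichZagier2001, §1.2] -/
def stub_primeRootAnchor : Prop :=
  ∀ p : ℕ, p.Prime → UnitRootRule p

/-- Obligation node of stub 2 (`stub_interpolantsExist`): INTERPOLANTS EXIST. [cite: KontsevichZagier2001, §1.1] -/
def stub_interpolantsExist : Prop :=
  InterpolantsExist

/-- Obligation node of stub 3 (`stub_rootTower`): THE ROOT TOWER — given interpolants, `RootRule a` and the
`b`-th root anchor give the `(a·b)`-th root anchor. [cite: KontsevichZagier2001, §1.2] -/
def stub_rootTower : Prop :=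
  InterpolantsExist → ∀ a b : ℕ, 1 ≤ a → 1 ≤ b → RootRule a → UnitRootRule b → UnitRootRule (a * b)

end Obligation

/-! ## The three registered stubs -/

/-- Stub 1 — PRIME-ROOT ANCHORS (the open core of the ω-rule): for every prime `p`, adjoining a `p`-th
root is admissible: from `[σ, f·g^m] − [τ, f'·g'^m] ∈ KZ.relations` for all `m ∈ ℕ` (`0 ≤ g, g' ≤ M`)
infer `[σ, f·g^{1/p}] − [τ, f'·g'^{1/p}] ∈ KZ.relations`. The instance `k = 1/p` of the crux; its first
cases in the route are `p = 2` (support `G2HalfRational`, continuation-free by cell decomposition) and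
`p = 3` (cruxes `G2ThirdAnchor`, `G2OverA2`; Gauss triplication, Neg 0311/0312). Why it might fail: it is
the genuine content of Carlson's rule — one finite chain must replace infinitely many unrelated
integer-point chains; a single inaccessible anchor (a Neg witness) refutes it together with the crux and
the summit. Size: open-problem. [cite: KontsevichZagier2001, §1.2] -/
theorem stub_primeRootAnchor : ∀ p : ℕ, p.Prime → UnitRootRule p := by
  sorry

/-- Stub 2 — INTERPOLANTS EXIST: under one side of the premisses, `[σ, f·g^k]` is a `KZ.IntegralRep` for
every rational `k ≥ 0`. Proof plan: `f = (r 0).integrand` and `f g = (r 1).integrand` on `σ` are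
ℚ-semialgebraic on `σ`; on `σ ∩ {f ≠ 0}` the quotient `g = (f g)/f` is semialgebraic (graph cut out by
`v·f(x) = (f g)(x)`), `g ≥ 0`, so `x ↦ (g x)^k` is semialgebraic (`IsSemialgebraicFunOn.rpow_ratCast_of_nonneg`,
Tarski–Seidenberg is `tarski_seidenberg_real_holds`) and so is the product with `f`
(`IsSemialgebraicFunOn.mul_holds`); on `σ ∩ {f = 0}` the integrand is `0`; glue by `IsSemialgebraicFunOn.union`;
integrability from `|f g^k| ≤ |f| + |f g^N|`, `N ≥ k` (`g ≥ 0`), i.e. domination by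
`|(r 0).integrand| + |(r N).integrand|`, measurability from `IsSemialgebraicFunOn.measurable_holds`.
Why it might fail: only through a slip in the piecewise description of the graph (the statement asks
nothing about `g` off `{f ≠ 0}`, where the integrand vanishes). Size M. [cite: KontsevichZagier2001, §1.1] -/
theorem stub_interpolantsExist : InterpolantsExist := by
  sorry

/-- Stub 3 — THE ROOT TOWER: denominators compose. Given that interpolants exist, `RootRule a` and the
`b`-th root anchor give the `(a·b)`-th root anchor: apply `UnitRootRule b` to the datum
`(σ, τ, f, G, f', G', M^{1/a}, R, S)` with `G = g^{1/a}`, `G' = g'^{1/a}` (`Real.rpow_nonneg`,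
`Real.rpow_le_rpow` for the bound), `R m`, `S m` the interpolants at `k = m/a` (stub 2 applied to each
side), whose premiss `[R m] − [S m] ∈ KZ.relations` is `RootRule a` at numerator `m`
(`G^m = g^{m/a}`: `Real.rpow_natCast`, `Real.rpow_mul`); its conclusion at `1/b` is the conclusion for
`g` at `(1/a)·(1/b) = 1/(a·b)` (`Real.rpow_mul`, `Nat.cast_mul`). Why it might fail: bookkeeping only if
the interpolants are fed with the wrong side's family; no analytic input. Size M.
[cite: KontsevichZagier2001, §1.2] -/
theorem stub_rootTower : InterpolantsExist → ∀ a b : ℕ, 1 ≤ a → 1 ≤ b →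
    RootRule a → UnitRootRule b → UnitRootRule (a * b) := by
  sorry

/-! ## Glue (proved): numerator freedom, the integer case, multiplicative induction, `k = num/den` -/

/-- NUMERATOR FREEDOM: the `q`-th root anchor gives the rule at every exponent `p/q` — apply the anchor
to the datum `(f, g^p; f', g'^p; M^p)` with the sub-families `m ↦ r (p·m)`, `m ↦ s (p·m)`, and use
`(g^p)^{1/q} = g^{p/q}` on `σ` (`g ≥ 0`). [cite: KontsevichZagier2001, §1.2] -/
theorem rootRule_of_unitRootRule {q : ℕ} (h : UnitRootRule q) : RootRule q := by
  intro n n' σ τ f g f' g' M r s hP p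
  obtain ⟨hg, hg', hr, hs, hrel⟩ := hP
  have hP' : Prem n n' σ τ f (fun x => g x ^ p) f' (fun y => g' y ^ p) (M ^ p)
      (fun j => r (p * j)) (fun j => s (p * j)) := by
    refine ⟨fun x hx => ⟨pow_nonneg (hg x hx).1 p, ?_⟩, fun y hy => ⟨pow_nonneg (hg' y hy).1 p, ?_⟩,
      fun j => ⟨(hr (p * j)).1, fun x hx => ?_⟩, fun j => ⟨(hs (p * j)).1, fun y hy => ?_⟩,
      fun j => hrel (p * j)⟩
    · exact pow_le_pow_left₀ (hg x hx).1 (hg x hx).2 p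
    · exact pow_le_pow_left₀ (hg' y hy).1 (hg' y hy).2 p
    · show (r (p * j)).integrand x = f x * (g x ^ p) ^ j
      rw [(hr (p * j)).2 hx]
      show f x * g x ^ (p * j) = f x * (g x ^ p) ^ j
      rw [pow_mul]
    · show (s (p * j)).integrand y = f' y * (g' y ^ p) ^ j
      rw [(hs (p * j)).2 hy]
      show f' y * g' y ^ (p * j) = f' y * (g' y ^ p) ^ j
      rw [pow_mul]
  have hC := h n n' σ τ f (fun x => g x ^ p) f' (fun y => g' y ^ p) (M ^ p) _ _ hP'
  intro rk sk h1 h2 h3 h4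
  refine hC rk sk h1 (fun x hx => ?_) h3 (fun y hy => ?_)
  · rw [h2 hx]
    show f x * g x ^ ((p : ℝ) / (q : ℝ)) = f x * (g x ^ p) ^ ((1 : ℝ) / (q : ℝ))
    rw [← Real.rpow_natCast (g x) p, ← Real.rpow_mul (hg x hx).1, mul_one_div]
  · rw [h4 hy]
    show f' y * g' y ^ ((p : ℝ) / (q : ℝ)) = f' y * (g' y ^ p) ^ ((1 : ℝ) / (q : ℝ))
    rw [← Real.rpow_natCast (g' y) p, ← Real.rpow_mul (hg' y hy).1, mul_one_div]

/-- Conversely (trivially) the rule at denominator `q` contains the `q`-th root anchor (numerator `1`).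
[cite: KontsevichZagier2001, §1.2] -/
theorem unitRootRule_of_rootRule {q : ℕ} (h : RootRule q) : UnitRootRule q := by
  intro n n' σ τ f g f' g' M r s hP
  have hC := h n n' σ τ f g f' g' M r s hP 1
  rwa [Nat.cast_one] at hC

/-- THE INTEGER CASE (`RootRule 1`): at `k = p ∈ ℕ` the conclusion follows from the `p`-th premiss and
two congruences in the calculus (representations with the same domain whose integrands agree on it
differ by a relation, `KZ.of_sub_of_mem_relations_of_eqOn`; `g^{(p:ℝ)} = g^p`, `Real.rpow_natCast`) —
§7 of `Cruxes/CarlsonKernel/Attack.lean`. [cite: KontsevichZagier2001, §1.2] -/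
theorem rootRule_one : RootRule 1 := by
  intro n n' σ τ f g f' g' M r s hP p rk sk h1 h2 h3 h4
  obtain ⟨hg, hg', hr, hs, hrel⟩ := hP
  have e1 : KZ.of rk - KZ.of (r p) ∈ KZ.relations := by
    refine KZ.of_sub_of_mem_relations_of_eqOn (by rw [(hr p).1, h1]) ?_
    intro x hx
    rw [h1] at hx
    rw [h2 hx, (hr p).2 hx]
    simp [Real.rpow_natCast]
  have e2 : KZ.of (s p) - KZ.of sk ∈ KZ.relations := by
    refine KZ.of_sub_of_mem_relations_of_eqOn (by rw [(hs p).1, h3]) ?_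
    intro y hy
    rw [(hs p).1] at hy
    rw [(hs p).2 hy, h4 hy]
    simp [Real.rpow_natCast]
  have key : KZ.of rk - KZ.of sk =
      (KZ.of rk - KZ.of (r p)) + (KZ.of (r p) - KZ.of (s p)) + (KZ.of (s p) - KZ.of sk) := by abel
  rw [key]
  exact add_mem (add_mem e1 (hrel p)) e2

/-- MULTIPLICATIVE INDUCTION ON THE DENOMINATOR: prime-root anchors and the root tower give the rule at
every denominator `q ≥ 1` (`Nat.recOnMul`; base `rootRule_one`). [cite: KontsevichZagier2001, §1.2] -/
theorem rootRule_of_prime_of_tower (hprime : ∀ p : ℕ, p.Prime → UnitRootRule p)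
    (htower : ∀ a b : ℕ, 1 ≤ a → 1 ≤ b → RootRule a → UnitRootRule b → UnitRootRule (a * b)) :
    ∀ q : ℕ, 1 ≤ q → RootRule q := by
  intro q
  induction q using Nat.recOnMul with
  | zero => intro hq; exact absurd hq (by norm_num)
  | one => intro _; exact rootRule_one
  | prime p hp => intro _; exact rootRule_of_unitRootRule (hprime p hp)
  | mul a b ha hb =>
    intro hab
    have ha1 : 1 ≤ a := Nat.one_le_iff_ne_zero.mpr (by rintro rfl; simp at hab)
    have hb1 : 1 ≤ b := Nat.one_le_iff_ne_zero.mpr (by rintro rfl; simp at hab)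
    exact rootRule_of_unitRootRule
      (htower a b ha1 hb1 (ha ha1) (unitRootRule_of_rootRule (hb hb1)))

/-- FROM DENOMINATORS TO EVERY RATIONAL EXPONENT: a rational `k ≥ 0` is `num/den` with `num ∈ ℕ`,
`den ≥ 1` (`Rat.cast_def`, `Rat.num_nonneg`, `Nat.cast_natAbs`). [cite: KontsevichZagier2001, §1.2] -/
theorem ratRule_of_rootRule (H : ∀ q : ℕ, 1 ≤ q → RootRule q) : RatRule := by
  intro n n' σ τ f g f' g' M r s hP k hk
  have hcast : (k : ℝ) = ((k.num.natAbs : ℕ) : ℝ) / ((k.den : ℕ) : ℝ) := by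
    rw [Nat.cast_natAbs, abs_of_nonneg (Rat.num_nonneg.2 hk), Rat.cast_def]
  have hC := H k.den k.den_pos n n' σ τ f g f' g' M r s hP k.num.natAbs
  rwa [← hcast] at hC

/-- The vocabulary is faithful: `RatRule` IS the crux, with its five premisses bracketed into `Prem` and its
conclusion named `Concl (k : ℝ)` (both directions are re-bracketing; nothing is unfolded but these two
definitions). [cite: KontsevichZagier2001, §1.2] -/
theorem ratRule_iff_carlsonClosure : RatRule ↔ CarlsonClosure := by
  constructor
  · intro h n n' σ τ f g f' g' M r s hg hg' hr hs hrel k hk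
    exact h n n' σ τ f g f' g' M r s ⟨hg, hg', hr, hs, hrel⟩ k hk
  · intro h n n' σ τ f g f' g' M r s hP k hk
    obtain ⟨hg, hg', hr, hs, hrel⟩ := hP
    exact h n n' σ τ f g f' g' M r s hg hg' hr hs hrel k hk

/-! ## Composition -/

/-- **Composition** (sorry-free): prime-root anchors, existence of interpolants and the root tower imply
the crux — `RootRule q` for all `q ≥ 1` by multiplicative induction, then `k = num/den`, then re-bracketing.
Hypotheses: the three obligation nodes `Obligation.stub_*` (= the stub signatures, by name). Concludes the
route declaration `Summit.KontsevichZagierPeriods.KontsevichZagierPeriods.Theses.CarlsonRule.CarlsonClosure`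
BY NAME. [cite: KontsevichZagier2001, §1.2] -/
theorem CarlsonClosure_of :
    Obligation.stub_primeRootAnchor → Obligation.stub_interpolantsExist → Obligation.stub_rootTower →
    Summit.KontsevichZagierPeriods.KontsevichZagierPeriods.Theses.CarlsonRule.CarlsonClosure :=
  fun hprime hexist htower =>
    ratRule_iff_carlsonClosure.1
      (ratRule_of_rootRule (rootRule_of_prime_of_tower hprime (htower hexist)))

/-- The by-name skeleton theorem (no hypotheses): the three sorried stubs fed into `CarlsonClosure_of` — their
signatures are definitionally the obligation nodes (its only `sorryAx` dependencies are `stub_primeRootAnchor`,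
`stub_interpolantsExist`, `stub_rootTower`). [cite: KontsevichZagier2001, §1.2] -/
theorem carlsonClosure_skeleton :
    Summit.KontsevichZagierPeriods.KontsevichZagierPeriods.Theses.CarlsonRule.CarlsonClosure :=
  CarlsonClosure_of stub_primeRootAnchor stub_interpolantsExist stub_rootTower

end Summit.KontsevichZagierPeriods.KontsevichZagierPeriods.Cruxes.CarlsonClosure.Birth
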